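import Literature.AnabelianGeometry.EtaleTheta.Discharge.Sec5Prop53ThetaOrbit

/-!
# [EtTh] §5, Proposition 5.3 (vi): a NON-VACUOUS instance form over ORDER COORDINATES on `Φ(A_⊚)^gp`
# (no "monoid type `ℤ`" structure; valid at PERFECT `Φ(A_⊚)`) — row F-0564

Mochizuki, *The étale theta function and its Frobenioid-theoretic manifestations*, Publ. RIMS **45** (2009), §5,
Prop. 5.3 (vi) p. 326 (PDF p. 100): `Ψ^Φ_{A_⊚}` preserves "the `Aut_C(A_⊚)`-orbit of the divisor of zeroes and poles
`∈ Φ(A_⊚)^gp` of … the theta function `Θ̈`"; proof p. 327 (PDF p. 101): "follows … in light of the preservation of (i),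
(ii), (iii), and (v) [cf. the description of the divisor of zeroes and poles of `Θ̈` in Proposition 1.4, (i)]"
[cite: MochizukiEtTh2009, Prop 5.3 (vi) p.326 (PDF p.100)]; Prop. 3.2 (i) p. 296 (PDF p. 70) (`Φ(A_⊚)` perf-factorial:
"a direct product of copies of `ℚ_{≥0}`" — the ORDERS at the primes); Prop. 5.1 p. 323 (PDF p. 97) (`Φ(−)` PERFECT).
Cell abc-iut, block F, seat abc-iut-f-128 (tranche 128, row F-0564 `PreservesThetaDivisorOrbit`).  PROOF-ONLY companion
(no `def`, no instance, nothing landed is edited) of abc-iut-L2-t4's `FrobenioidThetaDivisors.lean`; it re-runs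
abc-iut-L6-d1's derivation `Sec5Prop53ThetaOrbit.lean` (`preservesThetaDivisorOrbit_of_profile'`) with its structure
argument `𝔖 : DivisorSupportData' 𝔓` replaced by EXPLICIT HYPOTHESIS BINDERS on a family of order functions.

WHY.  The instance form OF RECORD of F-0564, `preservesThetaDivisorOrbit_of_profile' (𝔖 : DivisorSupportData' 𝔓) …`,
is VACUOUS at every §5 datum whose `Φ(A_⊚)` is perfect — abc-iut-f-127's `isEmpty_divisorSupportData'_of_isPerfect`
(p434934, `Sec5Prop53PerfectVacuity.lean`: the field `factor_carrier` forces `Φ(A_⊚)_𝔭 ≅ ℤ_{≥0}`), while Prop. 5.1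
says `Φ(−)` IS perfect.  The derivation itself never needs `ℤ_{≥0}`-components; it needs only:
* order coordinates `ord_𝔭 : Φ(A_⊚)^gp → ℚ` SEPARATING elements (`hsep`; Prop. 3.2 (i): the product-valued
  factorization is injective) — any functions, no homomorphism or integrality required;
* transport of orders `ord_𝔮(φ^gp x) = ord_{φ⁻¹𝔮}(x)` for `φ = Ψ^Φ_{A_⊚}` (`hψo`) and for every `φ ∈ Aut_C(A_⊚)`
  (part of `hAut`) — at monoid type `ℤ` a theorem (`DivisorSupportData'.ord_gpMap'`), here a binder;
* `hAut`: every `g ∈ Aut_C(A_⊚)` preserves cuspidality and acts on the labels of the chain through `ℤ ⋊ {±1}`;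
  `htrans`: every translation of the chain is realised (F6); `hdiv`: the non-cuspidal orders of `div(Θ̈)` follow a
  profile `θ` symmetric about `s/2` (Prop. 1.4 (i): `−j²·ord(q)/2`), `hcusp`: its cuspidal orders are one constant `κ`
  (print: `κ = 1`, "each zero has multiplicity 1"); and Prop. 5.3 (i) on primes (`hc`), (v) (`hL`).
RESULT: **`preservesThetaDivisorOrbit_of_orders`** — under these binders `PreservesThetaDivisorOrbit 𝔓 Ψ ι e` holds.
NON-VACUITY at a perfect datum with non-trivial `Aut_C(A_⊚)`-action: this seat's chain model (`Sec5Prop53ChainModel.lean`,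
`Φ = ⊕_{ℤ ⊔ ℤ} ℚ_{≥0}`, `ord_𝔭 =` the `idx 𝔭`-coordinate, `θ = 𝟙_{0}`, `κ = 0`) meets every binder (witness file to
follow once its parents are built).

HONEST FRAMING: kernel-checked implication about the TYPED data; the binders record print's inputs, they are asserted
nowhere; typed ≠ proved; no side taken on [IUTchIII] Cor. 3.12 or on any author.
-/

namespace Literature.AnabelianGeometry.EtaleTheta

open CategoryTheory
open Literature.AlgebraicGeometry.Frobenioids

universe w v v' u u'

namespace FrobenioidThetaDivisors

section Transport

variable {C : Type u} [Category.{v} C] {D : Type u'} [Category.{v'} D] {𝔉 : ThetaFrobenioid.{w} C D}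
  (ord : Primes 𝔉.PhiAcirc → Algebra.GrothendieckGroup 𝔉.PhiAcirc → ℚ)

/-- Transport of orders passes to the inverse automorphism: if `ord_𝔮(φ^gp x) = ord_{φ⁻¹𝔮}(x)` for all `𝔮, x`, then
`ord_𝔮((φ⁻¹)^gp x) = ord_{φ𝔮}(x)`. [cite: MochizukiEtTh2009, Prop 5.3 proof p.326 (PDF p.100)] -/
theorem ord_gpMap_symm_of_ord_gpMap (φ : 𝔉.PhiAcirc ≃* 𝔉.PhiAcirc)
    (hφo : ∀ 𝔮 x, ord 𝔮 (ThetaFrobenioid.gpMap (φ : 𝔉.PhiAcirc →* 𝔉.PhiAcirc) x) = ord (Primes.congr φ.symm 𝔮) x)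
    (𝔮 : Primes 𝔉.PhiAcirc) (x : Algebra.GrothendieckGroup 𝔉.PhiAcirc) :
    ord 𝔮 (ThetaFrobenioid.gpMap (φ.symm : 𝔉.PhiAcirc →* 𝔉.PhiAcirc) x) = ord (Primes.congr φ.symm.symm 𝔮) x := by
  have h := hφo (Primes.congr φ 𝔮) (ThetaFrobenioid.gpMap (φ.symm : 𝔉.PhiAcirc →* 𝔉.PhiAcirc) x)
  rw [Primes.congr_symm_apply_congr, ← MulEquiv.toMonoidHom_eq_coe, ← MulEquiv.toMonoidHom_eq_coe,
    DivisorSupportData.gpMap_gpMap_symm] at h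
  rw [← MulEquiv.toMonoidHom_eq_coe, ← h, MulEquiv.symm_symm]

end Transport

namespace DivisorPrimeData

variable {C : Type u} [Category.{v} C] {D : Type u'} [Category.{v'} D] {𝔉 : ThetaFrobenioid.{w} C D}
  (𝔓 : DivisorPrimeData 𝔉) (ord : Primes 𝔉.PhiAcirc → Algebra.GrothendieckGroup 𝔉.PhiAcirc → ℚ)

/-- **Transport of profiles** (order-coordinate form of abc-iut-L6-d1's `profile_gpMap'`).  If `φ` transports orders,
preserves cuspidality and acts on the labels by `j ↦ εj + c`, and `x` has cuspidal orders `κ` and non-cuspidal orders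
`θ(j − t)` for a profile `θ` with `θ (s − j) = θ j`, then `φ^gp x` has cuspidal orders `κ` and non-cuspidal orders
`θ(j − t')`, `t' = c + t` (`ε = 1`) resp. `c − t − s` (`ε = −1`). [cite: MochizukiEtTh2009, Prop 5.3 proof p.327 (PDF p.101)] -/
theorem profile_gpMap_of_orders (φ : 𝔉.PhiAcirc ≃* 𝔉.PhiAcirc)
    (hφo : ∀ 𝔮 x, ord 𝔮 (ThetaFrobenioid.gpMap (φ : 𝔉.PhiAcirc →* 𝔉.PhiAcirc) x) = ord (Primes.congr φ.symm 𝔮) x)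
    (hφc : ∀ 𝔭, 𝔓.IsCuspidal (Primes.congr φ 𝔭) ↔ 𝔓.IsCuspidal 𝔭) (ε : ℤˣ) (c : ℤ)
    (hφL : ∀ (𝔭 : Primes 𝔉.PhiAcirc) (h𝔭 : ¬ 𝔓.IsCuspidal 𝔭) (h𝔭' : ¬ 𝔓.IsCuspidal (Primes.congr φ 𝔭)),
      𝔓.ncspEquivZ ⟨Primes.congr φ 𝔭, h𝔭'⟩ = ε * 𝔓.ncspEquivZ ⟨𝔭, h𝔭⟩ + c)
    (κ : ℚ) (θ : ℤ → ℚ) (s : ℤ) (hθ : ∀ j, θ (s - j) = θ j) (x : Algebra.GrothendieckGroup 𝔉.PhiAcirc) (t : ℤ)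
    (hx₁ : ∀ 𝔠, 𝔓.IsCuspidal 𝔠 → ord 𝔠 x = κ)
    (hx₂ : ∀ (𝔫 : Primes 𝔉.PhiAcirc) (h𝔫 : ¬ 𝔓.IsCuspidal 𝔫), ord 𝔫 x = θ (𝔓.ncspEquivZ ⟨𝔫, h𝔫⟩ - t)) :
    (∀ 𝔠, 𝔓.IsCuspidal 𝔠 → ord 𝔠 (ThetaFrobenioid.gpMap (φ : 𝔉.PhiAcirc →* 𝔉.PhiAcirc) x) = κ) ∧
      ∀ (𝔫 : Primes 𝔉.PhiAcirc) (h𝔫 : ¬ 𝔓.IsCuspidal 𝔫),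
        ord 𝔫 (ThetaFrobenioid.gpMap (φ : 𝔉.PhiAcirc →* 𝔉.PhiAcirc) x) =
          θ (𝔓.ncspEquivZ ⟨𝔫, h𝔫⟩ - (if ε = 1 then c + t else c - t - s)) := by
  have hc' := 𝔓.isCuspidal_congr_symm_iff φ hφc
  have hL' := 𝔓.ncspEquivZ_congr_symm φ ε c hφL
  refine ⟨fun 𝔠 h𝔠 => ?_, fun 𝔫 h𝔫 => ?_⟩
  · rw [hφo]
    exact hx₁ _ ((hc' 𝔠).mpr h𝔠)
  · rw [hφo, hx₂ _ ((hc' 𝔫).not.mpr h𝔫), hL' 𝔫 h𝔫 ((hc' 𝔫).not.mpr h𝔫)]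
    rcases Int.units_eq_one_or ε with rfl | rfl
    · rw [if_pos rfl, Units.val_one]
      congr 1; ring
    · rw [if_neg (by decide), Units.val_neg, Units.val_one, ← hθ]
      congr 1; ring

/-- **The `Aut_C(A_⊚)`-orbit of `div(Θ̈)` is the set of elements with cuspidal orders `κ` and non-cuspidal orders a
translate of the profile `θ`** (order-coordinate form of abc-iut-L6-d1's `mem_thetaOrbit_iff_profile'`), given
separating orders, `hdiv`, `hcusp`, `hAut` and `htrans`. [cite: MochizukiEtTh2009, Prop 5.3 (vi) p.326 (PDF p.100); proof p.327 (PDF p.101)] -/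
theorem mem_thetaOrbit_iff_profile_of_orders (hsep : ∀ x y, (∀ 𝔭, ord 𝔭 x = ord 𝔭 y) → x = y)
    (κ : ℚ) (θ : ℤ → ℚ) (s : ℤ) (hθ : ∀ j, θ (s - j) = θ j)
    (hcusp : ∀ 𝔠, 𝔓.IsCuspidal 𝔠 → ord 𝔠 𝔓.divTheta = κ)
    (hdiv : ∀ (𝔫 : Primes 𝔉.PhiAcirc) (h𝔫 : ¬ 𝔓.IsCuspidal 𝔫), ord 𝔫 𝔓.divTheta = θ (𝔓.ncspEquivZ ⟨𝔫, h𝔫⟩))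
    (hAut : ∀ g : Aut 𝔉.Acirc,
      (∀ 𝔮 x, ord 𝔮 (ThetaFrobenioid.gpMap (𝔉.pullAut g : 𝔉.PhiAcirc →* 𝔉.PhiAcirc) x) =
        ord (Primes.congr (𝔉.pullAut g).symm 𝔮) x) ∧
      (∀ 𝔭, 𝔓.IsCuspidal (Primes.congr (𝔉.pullAut g) 𝔭) ↔ 𝔓.IsCuspidal 𝔭) ∧
      ∃ (ε : ℤˣ) (c : ℤ), ∀ (𝔭 : Primes 𝔉.PhiAcirc) (h𝔭 : ¬ 𝔓.IsCuspidal 𝔭)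
        (h𝔭' : ¬ 𝔓.IsCuspidal (Primes.congr (𝔉.pullAut g) 𝔭)),
        𝔓.ncspEquivZ ⟨Primes.congr (𝔉.pullAut g) 𝔭, h𝔭'⟩ = ε * 𝔓.ncspEquivZ ⟨𝔭, h𝔭⟩ + c)
    (htrans : ∀ t : ℤ, ∃ g : Aut 𝔉.Acirc,
      (∀ 𝔭, 𝔓.IsCuspidal (Primes.congr (𝔉.pullAut g) 𝔭) ↔ 𝔓.IsCuspidal 𝔭) ∧
      ∀ (𝔭 : Primes 𝔉.PhiAcirc) (h𝔭 : ¬ 𝔓.IsCuspidal 𝔭) (h𝔭' : ¬ 𝔓.IsCuspidal (Primes.congr (𝔉.pullAut g) 𝔭)),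
        𝔓.ncspEquivZ ⟨Primes.congr (𝔉.pullAut g) 𝔭, h𝔭'⟩ = 𝔓.ncspEquivZ ⟨𝔭, h𝔭⟩ + t)
    (x : Algebra.GrothendieckGroup 𝔉.PhiAcirc) :
    x ∈ Set.range (fun g : Aut 𝔉.Acirc =>
        ThetaFrobenioid.gpMap (𝔉.pullAut g : 𝔉.PhiAcirc →* 𝔉.PhiAcirc) 𝔓.divTheta) ↔
      ∃ t : ℤ, (∀ 𝔠, 𝔓.IsCuspidal 𝔠 → ord 𝔠 x = κ) ∧
        ∀ (𝔫 : Primes 𝔉.PhiAcirc) (h𝔫 : ¬ 𝔓.IsCuspidal 𝔫), ord 𝔫 x = θ (𝔓.ncspEquivZ ⟨𝔫, h𝔫⟩ - t) := by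
  have h0 : ∀ (𝔫 : Primes 𝔉.PhiAcirc) (h𝔫 : ¬ 𝔓.IsCuspidal 𝔫),
      ord 𝔫 𝔓.divTheta = θ (𝔓.ncspEquivZ ⟨𝔫, h𝔫⟩ - 0) := fun 𝔫 h𝔫 => by rw [sub_zero]; exact hdiv 𝔫 h𝔫
  constructor
  · rintro ⟨g, rfl⟩
    obtain ⟨hgo, hgc, ε, c, hgL⟩ := hAut g
    exact ⟨_, 𝔓.profile_gpMap_of_orders ord (𝔉.pullAut g) hgo hgc ε c hgL κ θ s hθ 𝔓.divTheta 0 hcusp h0⟩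
  · rintro ⟨t, h₁, h₂⟩
    obtain ⟨g, hgc, hgL⟩ := htrans t
    obtain ⟨hgo, -, -⟩ := hAut g
    have hgL' : ∀ (𝔭 : Primes 𝔉.PhiAcirc) (h𝔭 : ¬ 𝔓.IsCuspidal 𝔭)
        (h𝔭' : ¬ 𝔓.IsCuspidal (Primes.congr (𝔉.pullAut g) 𝔭)),
        𝔓.ncspEquivZ ⟨Primes.congr (𝔉.pullAut g) 𝔭, h𝔭'⟩ = ((1 : ℤˣ) : ℤ) * 𝔓.ncspEquivZ ⟨𝔭, h𝔭⟩ + t :=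
      fun 𝔭 h𝔭 h𝔭' => by rw [Units.val_one, one_mul]; exact hgL 𝔭 h𝔭 h𝔭'
    obtain ⟨k₁, k₂⟩ := 𝔓.profile_gpMap_of_orders ord (𝔉.pullAut g) hgo hgc 1 t hgL' κ θ s hθ 𝔓.divTheta 0 hcusp h0
    refine ⟨g, hsep _ _ fun 𝔭 => ?_⟩
    by_cases h𝔭 : 𝔓.IsCuspidal 𝔭
    · rw [k₁ 𝔭 h𝔭, h₁ 𝔭 h𝔭]
    · rw [k₂ 𝔭 h𝔭, h₂ 𝔭 h𝔭, if_pos rfl, add_zero]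

end DivisorPrimeData

/-! ### Proposition 5.3 (vi) from (i), (v) and the order coordinates -/

section Prop53vi

variable {C : Type u} [Category.{v} C] {D : Type u'} [Category.{v'} D] {𝔉 : ThetaFrobenioid.{w} C D}
  (𝔓 : DivisorPrimeData 𝔉) (Ψ : C ≌ C) (ι : Ψ.functor.obj 𝔉.Acirc ≅ 𝔉.Acirc)
  (e : 𝔉.PhiAcirc ≃* 𝔉.pre.Mon (𝔉.base.obj (Ψ.functor.obj 𝔉.Acirc)))

/-- **[EtTh] Prop. 5.3 (vi), NON-VACUOUS INSTANCE FORM over order coordinates (row F-0564)** — "`Ψ^Φ_{A_⊚}` preserves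
the `Aut_C(A_⊚)`-orbit of the divisor of zeroes and poles `∈ Φ(A_⊚)^gp` of … `Θ̈`" — from: separating order functions
`ord_𝔭 : Φ(A_⊚)^gp → ℚ` (`hsep`, Prop. 3.2 (i)), transport of orders under `Ψ^Φ_{A_⊚}` (`hψo`) and under `Aut_C(A_⊚)`
with cuspidality preserved and labels moved affinely (`hAut`), all translations realised (`htrans`, F6), the profile of
`div(Θ̈)` (`hdiv`, `hcusp`; Prop. 1.4 (i)), and Prop. 5.3 (i) on primes (`hc`), (v) (`hL`).  No "monoid type `ℤ`"
structure enters, so the form is satisfiable at PERFECT `Φ(A_⊚)` (Prop. 5.1).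
[cite: MochizukiEtTh2009, Prop 5.3 (vi) p.326 (PDF p.100); proof p.327 (PDF p.101); Prop 1.4 (i) p.247 (PDF p.21)] -/
theorem preservesThetaDivisorOrbit_of_orders (ord : Primes 𝔉.PhiAcirc → Algebra.GrothendieckGroup 𝔉.PhiAcirc → ℚ)
    (hsep : ∀ x y, (∀ 𝔭, ord 𝔭 x = ord 𝔭 y) → x = y) (hc : CuspPreserved 𝔓 Ψ ι e)
    (hL : PreservesNcspLabels 𝔓 Ψ ι e hc)
    (hψo : ∀ 𝔮 x, ord 𝔮 (ThetaFrobenioid.gpMap (psiPhi 𝔉 Ψ ι e : 𝔉.PhiAcirc →* 𝔉.PhiAcirc) x) =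
      ord (Primes.congr (psiPhi 𝔉 Ψ ι e).symm 𝔮) x)
    (κ : ℚ) (θ : ℤ → ℚ) (s : ℤ) (hθ : ∀ j, θ (s - j) = θ j)
    (hcusp : ∀ 𝔠, 𝔓.IsCuspidal 𝔠 → ord 𝔠 𝔓.divTheta = κ)
    (hdiv : ∀ (𝔫 : Primes 𝔉.PhiAcirc) (h𝔫 : ¬ 𝔓.IsCuspidal 𝔫), ord 𝔫 𝔓.divTheta = θ (𝔓.ncspEquivZ ⟨𝔫, h𝔫⟩))
    (hAut : ∀ g : Aut 𝔉.Acirc,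
      (∀ 𝔮 x, ord 𝔮 (ThetaFrobenioid.gpMap (𝔉.pullAut g : 𝔉.PhiAcirc →* 𝔉.PhiAcirc) x) =
        ord (Primes.congr (𝔉.pullAut g).symm 𝔮) x) ∧
      (∀ 𝔭, 𝔓.IsCuspidal (Primes.congr (𝔉.pullAut g) 𝔭) ↔ 𝔓.IsCuspidal 𝔭) ∧
      ∃ (ε : ℤˣ) (c : ℤ), ∀ (𝔭 : Primes 𝔉.PhiAcirc) (h𝔭 : ¬ 𝔓.IsCuspidal 𝔭)
        (h𝔭' : ¬ 𝔓.IsCuspidal (Primes.congr (𝔉.pullAut g) 𝔭)),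
        𝔓.ncspEquivZ ⟨Primes.congr (𝔉.pullAut g) 𝔭, h𝔭'⟩ = ε * 𝔓.ncspEquivZ ⟨𝔭, h𝔭⟩ + c)
    (htrans : ∀ t : ℤ, ∃ g : Aut 𝔉.Acirc,
      (∀ 𝔭, 𝔓.IsCuspidal (Primes.congr (𝔉.pullAut g) 𝔭) ↔ 𝔓.IsCuspidal 𝔭) ∧
      ∀ (𝔭 : Primes 𝔉.PhiAcirc) (h𝔭 : ¬ 𝔓.IsCuspidal 𝔭) (h𝔭' : ¬ 𝔓.IsCuspidal (Primes.congr (𝔉.pullAut g) 𝔭)),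
        𝔓.ncspEquivZ ⟨Primes.congr (𝔉.pullAut g) 𝔭, h𝔭'⟩ = 𝔓.ncspEquivZ ⟨𝔭, h𝔭⟩ + t) :
    PreservesThetaDivisorOrbit 𝔓 Ψ ι e := by
  obtain ⟨ε, c, hLab⟩ := hL
  set ψ := psiPhi 𝔉 Ψ ι e with hψ
  have hLab' : ∀ (𝔭 : Primes 𝔉.PhiAcirc) (h𝔭 : ¬ 𝔓.IsCuspidal 𝔭) (h𝔭' : ¬ 𝔓.IsCuspidal (Primes.congr ψ 𝔭)),
      𝔓.ncspEquivZ ⟨Primes.congr ψ 𝔭, h𝔭'⟩ = ε * 𝔓.ncspEquivZ ⟨𝔭, h𝔭⟩ + c := fun 𝔭 h𝔭 _ => hLab 𝔭 h𝔭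
  have hc' := 𝔓.isCuspidal_congr_symm_iff ψ hc
  have hL' := 𝔓.ncspEquivZ_congr_symm ψ ε c hLab'
  have hψo' := ord_gpMap_symm_of_ord_gpMap ord ψ hψo
  show _ '' _ = _
  ext x
  constructor
  · rintro ⟨y, hy, rfl⟩
    rw [𝔓.mem_thetaOrbit_iff_profile_of_orders ord hsep κ θ s hθ hcusp hdiv hAut htrans] at hy
    obtain ⟨t, h₁, h₂⟩ := hy
    exact (𝔓.mem_thetaOrbit_iff_profile_of_orders ord hsep κ θ s hθ hcusp hdiv hAut htrans _).mpr
      ⟨_, 𝔓.profile_gpMap_of_orders ord ψ hψo hc ε c hLab' κ θ s hθ y t h₁ h₂⟩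
  · intro hx
    rw [𝔓.mem_thetaOrbit_iff_profile_of_orders ord hsep κ θ s hθ hcusp hdiv hAut htrans] at hx
    obtain ⟨t, h₁, h₂⟩ := hx
    refine ⟨ThetaFrobenioid.gpMap (ψ.symm : 𝔉.PhiAcirc →* 𝔉.PhiAcirc) x,
      (𝔓.mem_thetaOrbit_iff_profile_of_orders ord hsep κ θ s hθ hcusp hdiv hAut htrans _).mpr
        ⟨_, 𝔓.profile_gpMap_of_orders ord ψ.symm hψo' hc' ε (-(ε * c)) hL' κ θ s hθ x t h₁ h₂⟩, ?_⟩
    rw [← MulEquiv.toMonoidHom_eq_coe, ← MulEquiv.toMonoidHom_eq_coe]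
    exact DivisorSupportData.gpMap_gpMap_symm ψ x

end Prop53vi

end FrobenioidThetaDivisors

end Literature.AnabelianGeometry.EtaleTheta
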